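import Summits.BirchSwinnertonDyer.BirchSwinnertonDyer.Theorems.Rank2ShaTierKit3
import Summits.BirchSwinnertonDyer.Rank1Residual.Partition.EisensteinKernelCertificate
import Summits.BirchSwinnertonDyer.Rank1Residual.Supersingular.X8Torsion
import Literature.NumberTheory.EllipticCurves.ShaOrderOfScaledMainConjectureInputsProofs
import HarnessLib

/-!
# BirchSwinnertonDyer — rank-2 `Ш[3^∞]` cell: the TIER KIT of frame «w16-bound» at `p = 3`
# (REDUCIBLE `E[3]`: Wuthrich 2014 Thm. 16 in place of Kato's (12.5.2))

HONEST FRAMING (cell `b2b-bsdr2sha`, run/shared/lean/b2b/bsd-rank2-sha/): per-pair certified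
theorems «cited hypotheses ∧ certified computation ⇒ `Ш(E/ℚ)[p^∞]` finite of order dividing `p^k`»
for rank-2 curves at good ordinary primes; NO claim on BSD in rank `≥ 2`, no class-level theorem,
every published input is a NAMED HYPOTHESIS of the tree (nothing is asserted or minted here).

Rows with `E[p]` REDUCIBLE have no kato-bound theorem (Kato's integral divisibility needs big image).
Wuthrich, Doc. Math. 19 (2014), Thm. 16 (p. 397) gives the integral divisibility `char X ∣ L_p` for
`p > 2`, `E` semistable at `p`, `E[p]` reducible — named fact `hW16 = Wuthrich2014.charIdeal_dvd_padicLFunction`;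
the tree's adapter `padicBSD_inequality_of_wuthrich16_odd_of_coeff_ne_zero_of_optimal`
(`Literature/…/ShaOrderOfScaledMainConjectureInputsProofs.lean`, LIT-1) turns it, with PRS (`hS`) and
Agashe–Ribet–Stein Thm. 2.6 (`h26`, Manin constant `1` for optimal curves of conductor `≤ 130000`) for an
OPTIMAL curve carrying a lattice-optimal parametrisation datum (`D`, `hopt`, `hN` — EXPLICIT binders of
the booked sentence, cell ruling (41)(b)), into the Stein–Wuthrich INEQUALITY
`ord_p #Ш[p^∞] + v((1 − α⁻¹)² ∏c_ℓ Reg_p) ≤ v([T^r]L_p · log_p(γ)^r · #E(ℚ)_tors²)`.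
This kit (cell ruling (41)(d), sub-tier G1-3 reducible rows) supplies the KERNEL side at `p = 3`:

* `padicValNat_card_shaPrimary_le_of_valuation_le` — frame-independent: the inequality ⇒
  `ord_p #Ш(E/ℚ)[p^∞] ≤ a + r + 2·ord_p #E(ℚ)_tors − 2·ord_p #Ẽ(𝔽_p) − ord_p ∏c_ℓ − b`;
* `red3Check e u⁺ u⁻ v` — KERNEL reducibility certificate at `3`: the rational number
  `x₀ = (u⁺ − u⁻)/v` is a root of `Ψ₃ = 3x⁴ + b₂x³ + 3b₄x² + 3b₆x + b₈` and not of
  `Ψ₂² = 4x³ + b₂x² + 2b₄x + b₆` (integer identities after clearing `v`); soundness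
  `not_irr_three_of_red3Check` via the sibling cell's `KernelDisc.exists_isRationalLine_of_eval_Ψ₃_eq_zero`
  (a rational `3`-line) and `not_hasIrreducibleModPGaloisRep_of_isRationalLine`;
* `torsFreeCheck e p ℓ sq n` — KERNEL certificate `p ∤ #E(ℚ)_tors`: a good odd prime `ℓ` with
  `#Ẽ(𝔽_ℓ) = n`, `p ∤ n` (a rational point of order `p` would force `p ∣ #Ẽ(𝔽_ℓ)`, Silverman AEC
  VII.3.1(b); sibling theorem `prime_dvd_reductionPointCount_of_dvd_torsionOrder`);
* `ShaRow.checkR₃ := check₃ ∧ red3Check` (reducible row, no torsion claim — reused by the torsion kits) and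
  `ShaRow.checkW₃ := checkR₃ ∧ torsFreeCheck`, read off the row's `SurjWitness` slots `(l₁, sq₁, n₁)` = the
  torsion prime `ℓ` and `(w₁, l₂, sq₂)` = `(v, u⁺, u⁻)`; soundness; `checkW₃_of_all`;
* `ShaRow.w16₃` (`ord_3 #Ш(E/ℚ)[3^∞] ≤ R.k`, the kato `k`-formula — torsion term certified `0`),
  `ShaRow.w16₃_eq_one` (`R.k ≤ 0 ⇒ Ш(E/ℚ)[3^∞] = 0`), READERS `booked_w16One₃` / `booked_w16Le₃`
  (certificates `R.checkW₃ = true ∧ R.k ≤ 0 ∧ 2 ≤ rank` / `R.checkW₃ = true ∧ 2 ≤ rank`).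

Not here: rows with `3 ∣ #E(ℚ)_tors` (torsion term live; needs a two-sided torsion certificate) and
reducible rows at `p ≥ 5` (certificate = a rational point of order `p`; 12 census cells) — later kits.

References: C. Wuthrich, Doc. Math. 19 (2014), Thm. 16 [Wuthrich2014]; A. Agashe, K. Ribet, W. Stein,
PAMQ 2 (2006), Thm. 2.6 [AgasheRibetStein2006]; J. Balakrishnan, J. S. Müller, W. Stein, Math. Comp. 85
(2016), Thm. 1.7 [BalakrishnanMullerStein2015]; W. Stein, C. Wuthrich, Math. Comp. 82 (2013), §§3–4, §8,
Alg. 11.1 [SteinWuthrich2013]; J. H. Silverman, AEC (2009), III Ex. 3.7, VII.3.1(b) [SilvermanAEC2009].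
-/

set_option autoImplicit false

-- single-conjunct summit: `Summit.BirchSwinnertonDyer.BirchSwinnertonDyer.…` repeats the name by design
set_option linter.dupNamespace false

noncomputable section

open scoped Classical MatrixGroups ModularForm

open CongruenceSubgroup WeierstrassCurve Polynomial Literature.NumberTheory.EllipticCurves
  Literature.NumberTheory.EllipticCurves.ModularForms
  Literature.NumberTheory.EllipticCurves.Rank1Residual
  Summit.BirchSwinnertonDyer.BirchSwinnertonDyer.Rank2Observatory
  Summit.BirchSwinnertonDyer.Rank1Residual

namespace Summit.BirchSwinnertonDyer.BirchSwinnertonDyer.Rank2Sha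

/-! ## §1. From the Stein–Wuthrich INEQUALITY to the bound on `ord_p #Ш` (frame-independent) -/

/-- **`ord_p #Ш(E/ℚ)[p^∞] ≤ a + r + 2·ord_p #E(ℚ)_tors − 2·ord_p #Ẽ(𝔽_p) − ord_p ∏c_ℓ − b`** from the
inequality `ord_p #Ш[p^∞] + v((1 − α⁻¹)² · ∏c_ℓ · Reg_p) ≤ v([T^r]L_p · log_p(γ)^r · #E(ℚ)_tors²)` (the
common OUTPUT of the tree's bound adapters: Kato without big image, Wuthrich Thm. 16), for `W/ℚ` globally
minimal elliptic, `p` odd good ordinary, `Ш[p^∞]` finite, `Reg_p ≠ 0`, `[T^r]L_p ≠ 0`, `ord_p [T^r]L_p = a`,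
`ord_p Reg_p = b` (`ord_p log_p(1+p) = 1`, `ord_p(1 − α⁻¹) = ord_p #Ẽ(𝔽_p)`).
[cite: SteinWuthrich2013, §§3–4, §8 and Alg. 11.1] [cite: BalakrishnanMullerStein2015, Thm. 1.7] -/
theorem padicValNat_card_shaPrimary_le_of_valuation_le
    (W : WeierstrassCurve ℚ) [W.IsElliptic] [W.IsGloballyMinimal] (p : ℕ) [Fact p.Prime]
    (hp2 : p ≠ 2) (hordin : IsOrdinaryAt W p) {N : ℕ} [NeZero N] (f : CuspForm (Gamma0 N) 2)
    (Dh : PAdicHeightData W p) [Finite (AddCommGroup.primaryComponent W.sha p)]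
    (hR0 : padicRegulator Dh ≠ 0) {r : ℕ}
    (hLp : PowerSeries.coeff r (padicLFunction f (unitRoot W p : ℚ_[p])) ≠ 0)
    (hle : (padicValNat p (Nat.card (AddCommGroup.primaryComponent W.sha p)) : ℤ) +
          ((1 - (unitRoot W p : ℚ_[p])⁻¹) ^ 2 * (W.tamagawaProduct : ℚ_[p]) *
            padicRegulator Dh).valuation ≤
        (PowerSeries.coeff r (padicLFunction f (unitRoot W p : ℚ_[p])) *
          (padicLog p (cyclotomicGenerator p) ^ r * (W.torsionOrder : ℚ_[p]) ^ 2)).valuation)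
    {a b : ℤ}
    (hcoeff : (PowerSeries.coeff r (padicLFunction f (unitRoot W p : ℚ_[p]))).valuation = a)
    (hreg : (padicRegulator Dh).valuation = b) :
    (padicValNat p (Nat.card (AddCommGroup.primaryComponent W.sha p)) : ℤ) ≤
      a + r + 2 * padicValNat p W.torsionOrder -
        2 * padicValNat p (W.reductionPointCount p) - padicValNat p W.tamagawaProduct - b := by
  obtain ⟨u₂, hu₂⟩ := exists_unit_one_sub_unitRoot_inv p W hordin
  have hN0 : (W.reductionPointCount p : ℚ_[p]) ≠ 0 := by
    exact_mod_cast (W.reductionPointCount_pos p).ne'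
  have hε0 : (1 - (unitRoot W p : ℚ_[p])⁻¹) ≠ 0 := by
    rw [hu₂]; exact mul_ne_zero (coe_units_ne_zero p u₂) hN0
  have hvε : ((1 - (unitRoot W p : ℚ_[p])⁻¹) ^ 2).valuation =
      2 * (padicValNat p (W.reductionPointCount p) : ℤ) := by
    rw [Padic.valuation_pow, hu₂, Padic.valuation_mul (coe_units_ne_zero p u₂) hN0,
      valuation_coe_units_eq_zero, zero_add, Padic.valuation_natCast]
    push_cast; ring
  have hc0 : (W.tamagawaProduct : ℚ_[p]) ≠ 0 := by
    exact_mod_cast (W.tamagawaProduct_pos_holds : 0 < W.tamagawaProduct).ne'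
  have ht0 : (W.torsionOrder : ℚ_[p]) ≠ 0 := by
    exact_mod_cast (W.torsionOrder_pos_holds : 0 < W.torsionOrder).ne'
  obtain ⟨u₃, hu₃⟩ := exists_unit_padicLog_cyclotomicGenerator p hp2
  have hp0 : (p : ℚ_[p]) ≠ 0 := Nat.cast_ne_zero.mpr (Fact.out : p.Prime).ne_zero
  have hlog0 : padicLog p (cyclotomicGenerator p : ℚ_[p]) ≠ 0 := by
    rw [hu₃]; exact mul_ne_zero hp0 (coe_units_ne_zero p u₃)
  have hvlog : (padicLog p (cyclotomicGenerator p : ℚ_[p]) ^ r).valuation = (r : ℤ) := by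
    rw [Padic.valuation_pow, hu₃, Padic.valuation_mul hp0 (coe_units_ne_zero p u₃),
      valuation_coe_units_eq_zero, add_zero, Padic.valuation_p]
    ring
  have hvtors : ((W.torsionOrder : ℚ_[p]) ^ 2).valuation = 2 * (padicValNat p W.torsionOrder : ℤ) := by
    rw [Padic.valuation_pow, Padic.valuation_natCast]
    push_cast; ring
  rw [Padic.valuation_mul (mul_ne_zero (pow_ne_zero 2 hε0) hc0) hR0,
    Padic.valuation_mul (pow_ne_zero 2 hε0) hc0, hvε, Padic.valuation_natCast, hreg,
    Padic.valuation_mul hLp (mul_ne_zero (pow_ne_zero _ hlog0) (pow_ne_zero 2 ht0)),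
    hcoeff, Padic.valuation_mul (pow_ne_zero _ hlog0) (pow_ne_zero 2 ht0), hvlog, hvtors] at hle
  linarith

/-! ## §2. The kernel reducibility certificate at `3`: a rational root of `Ψ₃` -/

/-- **Kernel reducibility certificate at `3`** on an integer model: with `x₀ = (u⁺ − u⁻)/v` (`v > 0`),
`v⁴·Ψ₃(x₀) = 3u⁴ + b₂u³v + 3b₄u²v² + 3b₆uv³ + b₈v⁴ = 0` and `v³·Ψ₂²(x₀) = 4u³ + b₂u²v + 2b₄uv² + b₆v³ ≠ 0`
(`u = u⁺ − u⁻`). [cite: SilvermanAEC2009, III Ex. 3.7] -/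
def red3Check (e : WeierstrassCurve ℤ) (up um v : ℕ) : Bool :=
  decide (0 < v) &&
    decide (3 * ((up : ℤ) - um) ^ 4 + e.b₂ * ((up : ℤ) - um) ^ 3 * v +
        3 * e.b₄ * ((up : ℤ) - um) ^ 2 * v ^ 2 + 3 * e.b₆ * ((up : ℤ) - um) * v ^ 3 + e.b₈ * v ^ 4 = 0) &&
    decide (4 * ((up : ℤ) - um) ^ 3 + e.b₂ * ((up : ℤ) - um) ^ 2 * v + 2 * e.b₄ * ((up : ℤ) - um) * v ^ 2 +
        e.b₆ * v ^ 3 ≠ 0)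

/-- `Ψ₃` of the base change of an integer model, evaluated at `u/v` and cleared of denominators. [folklore] -/
theorem eval_Ψ₃_baseChange_int (e : WeierstrassCurve ℤ) (u : ℤ) (v : ℕ) (hv : (v : ℚ) ≠ 0) :
    (e.baseChange ℚ).Ψ₃.eval ((u : ℚ) / v) * (v : ℚ) ^ 4 =
      ((3 * u ^ 4 + e.b₂ * u ^ 3 * v + 3 * e.b₄ * u ^ 2 * v ^ 2 + 3 * e.b₆ * u * v ^ 3 + e.b₈ * v ^ 4 : ℤ) : ℚ) := by
  simp only [WeierstrassCurve.Ψ₃, eval_add, eval_mul, eval_pow, eval_C, eval_X, eval_ofNat,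
    WeierstrassCurve.baseChange, WeierstrassCurve.map_b₂, WeierstrassCurve.map_b₄,
    WeierstrassCurve.map_b₆, WeierstrassCurve.map_b₈, algebraMap_int_eq, eq_intCast]
  push_cast
  field_simp

/-- `Ψ₂²` of the base change of an integer model, evaluated at `u/v` and cleared of denominators. [folklore] -/
theorem eval_Ψ₂Sq_baseChange_int (e : WeierstrassCurve ℤ) (u : ℤ) (v : ℕ) (hv : (v : ℚ) ≠ 0) :
    (e.baseChange ℚ).Ψ₂Sq.eval ((u : ℚ) / v) * (v : ℚ) ^ 3 =
      ((4 * u ^ 3 + e.b₂ * u ^ 2 * v + 2 * e.b₄ * u * v ^ 2 + e.b₆ * v ^ 3 : ℤ) : ℚ) := by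
  simp only [WeierstrassCurve.Ψ₂Sq, eval_add, eval_mul, eval_pow, eval_C, eval_X,
    WeierstrassCurve.baseChange, WeierstrassCurve.map_b₂, WeierstrassCurve.map_b₄,
    WeierstrassCurve.map_b₆, algebraMap_int_eq, eq_intCast]
  push_cast
  field_simp

/-- **Soundness of `red3Check`**: `E[3]` is REDUCIBLE (a rational root of `Ψ₃` outside `Ψ₂²` spans a
`Γ_ℚ`-stable line of order `3`: the sibling cell's `KernelDisc.exists_isRationalLine_of_eval_Ψ₃_eq_zero`).
[cite: SilvermanAEC2009, III Ex. 3.7] -/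
theorem not_irr_three_of_red3Check {e : WeierstrassCurve ℤ} {up um v : ℕ}
    (h : red3Check e up um v = true) [(e.baseChange ℚ).IsElliptic] :
    ¬ (e.baseChange ℚ).HasIrreducibleModPGaloisRep 3 := by
  simp only [red3Check, Bool.and_eq_true, decide_eq_true_eq] at h
  obtain ⟨⟨hv, hψ⟩, hd⟩ := h
  have hvq : (v : ℚ) ≠ 0 := by exact_mod_cast hv.ne'
  set x₀ : ℚ := (((up : ℤ) - um : ℤ) : ℚ) / v with hx₀
  have hψ' : (e.baseChange ℚ).Ψ₃.eval x₀ = 0 := by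
    have h1 := eval_Ψ₃_baseChange_int e ((up : ℤ) - um) v hvq
    rw [hψ, Int.cast_zero] at h1
    exact (mul_eq_zero.mp h1).resolve_right (pow_ne_zero 4 hvq)
  have hd' : (e.baseChange ℚ).Ψ₂Sq.eval x₀ ≠ 0 := by
    intro h0
    have h1 := eval_Ψ₂Sq_baseChange_int e ((up : ℤ) - um) v hvq
    rw [h0, zero_mul] at h1
    exact hd (by exact_mod_cast h1.symm)
  obtain ⟨Φ, -, -, -, hΦ, -⟩ := KernelDisc.exists_isRationalLine_of_eval_Ψ₃_eq_zero x₀ hψ' hd'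
  exact not_hasIrreducibleModPGaloisRep_of_isRationalLine hΦ

/-! ## §3. The kernel certificate `p ∤ #E(ℚ)_tors` -/

/-- **Kernel certificate `p ∤ #E(ℚ)_tors`**: a good odd prime `ℓ` (trial division datum `sq = ⌊√ℓ⌋`)
with `ℓ ∤ Δ`, kernel point count `#Ẽ(𝔽_ℓ) = n` and `p ∤ n`. [cite: SilvermanAEC2009, VII.3.1(b)] -/
def torsFreeCheck (e : WeierstrassCurve ℤ) (p ℓ sq n : ℕ) : Bool :=
  Tam.TamLocal.primeB ℓ sq && decide (ℓ ≠ 2) && decide (¬ ((ℓ : ℤ) ∣ e.Δ)) &&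
    decide (curveCount ℓ e = n) && decide (¬ (p ∣ n))

/-- **Soundness of `torsFreeCheck`**: `p ∤ #E(ℚ)_tors` (a prime dividing `#E(ℚ)_tors` divides `#Ẽ(𝔽_ℓ)`
at every good prime `ℓ ≥ 3`; sibling theorem `prime_dvd_reductionPointCount_of_dvd_torsionOrder`), hence
`ord_p #E(ℚ)_tors = 0`. [cite: SilvermanAEC2009, VII.3.1(b) and VIII.7.1] -/
theorem padicValNat_torsionOrder_eq_zero_of_torsFreeCheck {e : WeierstrassCurve ℤ} {p ℓ sq n : ℕ}
    (h : torsFreeCheck e p ℓ sq n = true) [Fact p.Prime] [(e.baseChange ℚ).IsElliptic]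
    [(e.baseChange ℚ).IsGloballyMinimal] : padicValNat p (e.baseChange ℚ).torsionOrder = 0 := by
  simp only [torsFreeCheck, Bool.and_eq_true, decide_eq_true_eq] at h
  obtain ⟨⟨⟨⟨hP, h2⟩, hΔ⟩, hN⟩, hpn⟩ := h
  have hℓ : ℓ.Prime := Tam.TamLocal.prime_of_primeB hP
  haveI : Fact ℓ.Prime := ⟨hℓ⟩
  have h3 : 3 ≤ ℓ := by have := hℓ.two_le; omega
  have hgood : (e.baseChange ℚ).HasGoodReductionAtPrime ℓ :=
    hasGoodReductionAtPrime_of_not_dvd _ ℓ (by rw [minimalDiscriminantInt_baseChange_int]; exact hΔ)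
  refine padicValNat.eq_zero_of_not_dvd fun hdvd => hpn ?_
  have hd := Supersingular.prime_dvd_reductionPointCount_of_dvd_torsionOrder (e.baseChange ℚ) ℓ h3 hgood
    (Fact.out : p.Prime) hdvd
  rwa [reductionPointCount_baseChange_int, card_eq_curveCount ℓ h2 e hΔ, hN] at hd

/-! ## §4. The compact row of frame «w16-bound» at `p = 3` -/

namespace ShaRow

variable (R : ShaRow)

/-- **The kernel test of a `p = 3` row with REDUCIBLE `E[3]`** (no torsion claim; shared by the
torsion-free frame below and the torsion frames of later kits): the `p = 3` base test `check₃` (good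
ordinary at `3`, minimal model, exact Tamagawa certificate) AND the reducibility certificate `red3Check`
read in the slots `(w₁, l₂, sq₂) = (v, u⁺, u⁻)` of `R.sw`. [cite: Wuthrich2014, Thm. 16 (p. 397)] -/
def checkR₃ : Bool :=
  R.check₃ && red3Check R.e R.sw.l₂ R.sw.sq₂ R.sw.w₁

/-- **The kernel test of a `p = 3` row of frame «w16-bound», torsion-free case** (`3 ∤ #E(ℚ)_tors`):
`checkR₃` AND the torsion certificate `torsFreeCheck` read in the slots `(l₁, sq₁, n₁)` of `R.sw`.
[cite: Wuthrich2014, Thm. 16 (p. 397)] [cite: SilvermanAEC2009, VII.3.1(b)] -/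
def checkW₃ : Bool :=
  R.checkR₃ && torsFreeCheck R.e 3 R.sw.l₁ R.sw.sq₁ R.sw.n₁

variable {R}

/-- A row passing `checkR₃` passes `check₃`. [folklore] -/
theorem check₃_of_checkR₃ (h : R.checkR₃ = true) : R.check₃ = true := by
  simp only [checkR₃, Bool.and_eq_true] at h; exact h.1

/-- A row passing `checkR₃` has REDUCIBLE `E[3]` (once the curve is known elliptic). [cite: SilvermanAEC2009, III Ex. 3.7] -/
theorem not_irr_of_checkR₃ (h : R.checkR₃ = true) [(R.e.baseChange ℚ).IsElliptic] :
    ¬ (R.e.baseChange ℚ).HasIrreducibleModPGaloisRep 3 := by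
  simp only [checkR₃, Bool.and_eq_true] at h
  exact not_irr_three_of_red3Check h.2

/-- A row passing `checkW₃` passes `checkR₃`. [folklore] -/
theorem checkR₃_of_checkW₃ (h : R.checkW₃ = true) : R.checkR₃ = true := by
  simp only [checkW₃, Bool.and_eq_true] at h; exact h.1

/-- A row passing `checkW₃` passes `check₃`. [folklore] -/
theorem check₃_of_checkW₃ (h : R.checkW₃ = true) : R.check₃ = true :=
  check₃_of_checkR₃ (checkR₃_of_checkW₃ h)

/-- A row passing `checkW₃` passes the torsion certificate. [folklore] -/
theorem torsFreeCheck_of_checkW₃ (h : R.checkW₃ = true) :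
    torsFreeCheck R.e 3 R.sw.l₁ R.sw.sq₁ R.sw.n₁ = true := by
  simp only [checkW₃, Bool.and_eq_true] at h; exact h.2

/-- From a tier theorem `rows.all checkW₃ = true` to the test of a member. [folklore] -/
theorem checkW₃_of_all {rows : List ShaRow} (hall : rows.all ShaRow.checkW₃ = true) {R : ShaRow}
    (hmem : R ∈ rows) : R.checkW₃ = true :=
  List.all_eq_true.mp hall R hmem

/-- **TIER ROW THEOREM at `p = 3`, frame «w16-bound».** For a compact row `R` passing `checkW₃` (kernel:
`p = 3` good ordinary, minimal model, exact Tamagawa certificate, `E[3]` REDUCIBLE by a rational root of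
`Ψ₃`, `3 ∤ #E(ℚ)_tors` by a good prime), GIVEN the named facts `hW16` (Wuthrich 2014 Thm. 16), `hS` (PRS,
BMS Thm. 1.7), `h26` (Agashe–Ribet–Stein 2006 Thm. 2.6), an EXPLICIT lattice-optimal parametrisation
datum `D` at a level `N ≤ 130000` (`hopt`, `hN`; its newform `D.f` is the row's `f`), the rank
certificate `hlow : 2 ≤ rank`, `hLp : [T²] L_3 ≠ 0`, `hcoeff : ord_3 [T²] L_3 = R.a`, THE canonical
`3`-adic height `Dh` with `hreg : ord_3 Reg_3 = R.b`: `rank_ℤ E(ℚ) = 2`, `Ш(E/ℚ)[3^∞]` finite, `Reg_3 ≠ 0`,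
`ord_3 #Ш(E/ℚ)[3^∞] ≤ R.k` (`R.k = R.a + 2 − 2·ord_3 #Ẽ(𝔽₃) − ord_3 ∏c_ℓ − R.b`; the torsion term of
Thm. 16's bound is certified `0`). Per pair; NOT a class theorem. [cite: Wuthrich2014, Thm. 16 (p. 397)]
[cite: AgasheRibetStein2006, Thm. 2.6] [cite: BalakrishnanMullerStein2015, Thm. 1.7]
[cite: SteinWuthrich2013, §§3–4 and Alg. 11.1] -/
theorem w16₃ (h : R.checkW₃ = true) [(R.e.baseChange ℚ).IsElliptic] [(R.e.baseChange ℚ).IsGloballyMinimal]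
    (hW16 : Wuthrich2014.charIdeal_dvd_padicLFunction) (hS : Schneider1985_order_charGenerator_odd)
    (h26 : AgasheRibetStein2006.cremona_abs_maninConstant_eq_one_of_level_le)
    {N : ℕ} [NeZero N] (D : ModularParametrizationData (R.e.baseChange ℚ) N)
    (hopt : ∀ z ∈ D.L.lattice, ∃ w ∈ periodLattice D.f, z = D.c * w) (hN : N ≤ 130000)
    (hlow : 2 ≤ (R.e.baseChange ℚ).mordellWeilRank)
    (hLp : PowerSeries.coeff 2 (padicLFunction D.f (unitRoot (R.e.baseChange ℚ) 3 : ℚ_[3])) ≠ 0)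
    (hcoeff : (PowerSeries.coeff 2
      (padicLFunction D.f (unitRoot (R.e.baseChange ℚ) 3 : ℚ_[3]))).valuation = R.a)
    (Dh : PAdicHeightData (R.e.baseChange ℚ) 3) (hDh : Dh.IsCanonical)
    (hreg : (padicRegulator Dh).valuation = R.b) :
    (R.e.baseChange ℚ).mordellWeilRank = 2 ∧
      Finite (AddCommGroup.primaryComponent (R.e.baseChange ℚ).sha 3) ∧ SchneiderConjecture Dh ∧
      (padicValNat 3 (Nat.card (AddCommGroup.primaryComponent (R.e.baseChange ℚ).sha 3)) : ℤ) ≤ R.k := by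
  have hb := check₃_of_checkW₃ h
  have hordin := isOrdinaryAt₃ hb
  have hred := not_irr_of_checkR₃ (checkR₃_of_checkW₃ h)
  obtain ⟨hr, hfin, hSch, hle⟩ := padicBSD_inequality_of_wuthrich16_odd_of_coeff_ne_zero_of_optimal
    hW16 hS h26 (R.e.baseChange ℚ) 3 (by decide) hordin.1 hordin.2 hred D hopt hN Dh hDh hlow hLp
  haveI := hfin
  refine ⟨hr, hfin, hSch, ?_⟩
  have hk := padicValNat_card_shaPrimary_le_of_valuation_le (R.e.baseChange ℚ) 3 (by decide) hordin D.f
    Dh hSch hLp hle hcoeff hreg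
  rw [padicValNat_torsionOrder_eq_zero_of_torsFreeCheck (torsFreeCheck_of_checkW₃ h),
    (reductionPointCount_eq_and_tamagawaProduct_eq₃ hb).1,
    (reductionPointCount_eq_and_tamagawaProduct_eq₃ hb).2] at hk
  rw [ShaRow.k, p_eq_three hb]
  push_cast at hk ⊢
  linarith

/-- **`p = 3`, frame «w16-bound», `R.k ≤ 0`: `Ш(E/ℚ)[3^∞] = 0` exactly.** [cite: Wuthrich2014, Thm. 16 (p. 397)]
[cite: SteinWuthrich2013, Thm. 1.1 and Alg. 11.1] -/
theorem w16₃_eq_one (h : R.checkW₃ = true) [(R.e.baseChange ℚ).IsElliptic]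
    [(R.e.baseChange ℚ).IsGloballyMinimal]
    (hW16 : Wuthrich2014.charIdeal_dvd_padicLFunction) (hS : Schneider1985_order_charGenerator_odd)
    (h26 : AgasheRibetStein2006.cremona_abs_maninConstant_eq_one_of_level_le)
    {N : ℕ} [NeZero N] (D : ModularParametrizationData (R.e.baseChange ℚ) N)
    (hopt : ∀ z ∈ D.L.lattice, ∃ w ∈ periodLattice D.f, z = D.c * w) (hN : N ≤ 130000)
    (hlow : 2 ≤ (R.e.baseChange ℚ).mordellWeilRank)
    (hLp : PowerSeries.coeff 2 (padicLFunction D.f (unitRoot (R.e.baseChange ℚ) 3 : ℚ_[3])) ≠ 0)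
    (hcoeff : (PowerSeries.coeff 2
      (padicLFunction D.f (unitRoot (R.e.baseChange ℚ) 3 : ℚ_[3]))).valuation = R.a)
    (Dh : PAdicHeightData (R.e.baseChange ℚ) 3) (hDh : Dh.IsCanonical)
    (hreg : (padicRegulator Dh).valuation = R.b) (hk0 : R.k ≤ 0) :
    (R.e.baseChange ℚ).mordellWeilRank = 2 ∧
      Finite (AddCommGroup.primaryComponent (R.e.baseChange ℚ).sha 3) ∧ SchneiderConjecture Dh ∧
      Nat.card (AddCommGroup.primaryComponent (R.e.baseChange ℚ).sha 3) = 1 := by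
  obtain ⟨hr, hfin, hSch, hle⟩ := w16₃ h hW16 hS h26 D hopt hN hlow hLp hcoeff Dh hDh hreg
  haveI := hfin
  have hv0 : padicValNat 3 (Nat.card (AddCommGroup.primaryComponent (R.e.baseChange ℚ).sha 3)) = 0 := by
    have := hle.trans hk0
    omega
  have hndvd : ¬ 3 ∣ Nat.card (AddCommGroup.primaryComponent (R.e.baseChange ℚ).sha 3) := by
    rcases padicValNat.eq_zero_iff.mp hv0 with h1 | h0 | hnd
    · exact absurd h1 (by decide)
    · exact absurd h0 Nat.card_pos.ne'
    · exact hnd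
  exact ⟨hr, hfin, hSch, natCard_primaryComponent_eq_one 3 hndvd⟩

/-! ## §5. Readers (instances built from the certificate inside the statement) -/

/-- **READER at `p = 3`, frame «w16-bound», V-BOUND 0** («`Ш(E/ℚ)[3^∞] = 0`»): from the row certificate
`checkW₃ ∧ k ≤ 0 ∧ 2 ≤ rank`, GIVEN `hW16`, `hS`, `h26`, the EXPLICIT optimal datum (`D`, `hopt`, `hN`), the
L-datum and THE canonical `3`-adic height datum: `rank_ℤ E(ℚ) = 2`, `Ш(E/ℚ)[3^∞]` finite, `Reg_3 ≠ 0`,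
`#Ш(E/ℚ)[3^∞] = 1`. [cite: Wuthrich2014, Thm. 16 (p. 397)] [cite: AgasheRibetStein2006, Thm. 2.6]
[cite: SteinWuthrich2013, Alg. 11.1 and Prop. 11.2] -/
theorem booked_w16One₃ (h : R.checkW₃ = true ∧ R.k ≤ 0 ∧ 2 ≤ (R.e.baseChange ℚ).mordellWeilRank) :
    haveI := (isElliptic_and_isGloballyMinimal₃ (check₃_of_checkW₃ h.1)).1
    haveI := (isElliptic_and_isGloballyMinimal₃ (check₃_of_checkW₃ h.1)).2
    ∀ (_hW16 : Wuthrich2014.charIdeal_dvd_padicLFunction) (_hS : Schneider1985_order_charGenerator_odd)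
      (_h26 : AgasheRibetStein2006.cremona_abs_maninConstant_eq_one_of_level_le)
      {N : ℕ} [NeZero N] (D : ModularParametrizationData (R.e.baseChange ℚ) N)
      (_hopt : ∀ z ∈ D.L.lattice, ∃ w ∈ periodLattice D.f, z = D.c * w) (_hN : N ≤ 130000)
      (_hLp : PowerSeries.coeff 2 (padicLFunction D.f (unitRoot (R.e.baseChange ℚ) 3 : ℚ_[3])) ≠ 0)
      (_hcoeff : (PowerSeries.coeff 2
        (padicLFunction D.f (unitRoot (R.e.baseChange ℚ) 3 : ℚ_[3]))).valuation = R.a)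
      (Dh : PAdicHeightData (R.e.baseChange ℚ) 3) (_hDh : Dh.IsCanonical)
      (_hreg : (padicRegulator Dh).valuation = R.b),
      (R.e.baseChange ℚ).mordellWeilRank = 2 ∧
        Finite (AddCommGroup.primaryComponent (R.e.baseChange ℚ).sha 3) ∧ SchneiderConjecture Dh ∧
        Nat.card (AddCommGroup.primaryComponent (R.e.baseChange ℚ).sha 3) = 1 := by
  intro hW16 hS h26 N _ D hopt hN hLp hcoeff Dh hDh hreg
  haveI := (isElliptic_and_isGloballyMinimal₃ (check₃_of_checkW₃ h.1)).1
  haveI := (isElliptic_and_isGloballyMinimal₃ (check₃_of_checkW₃ h.1)).2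
  exact w16₃_eq_one h.1 hW16 hS h26 D hopt hN h.2.2 hLp hcoeff Dh hDh hreg h.2.1

/-- **READER at `p = 3`, frame «w16-bound», V-BOUND `b`**: from `checkW₃ ∧ 2 ≤ rank`: `rank = 2`,
`Ш(E/ℚ)[3^∞]` finite, `Reg_3 ≠ 0`, `ord_3 #Ш(E/ℚ)[3^∞] ≤ R.k`. [cite: Wuthrich2014, Thm. 16 (p. 397)]
[cite: AgasheRibetStein2006, Thm. 2.6] [cite: SteinWuthrich2013, Alg. 11.1 and Prop. 11.2] -/
theorem booked_w16Le₃ (h : R.checkW₃ = true ∧ 2 ≤ (R.e.baseChange ℚ).mordellWeilRank) :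
    haveI := (isElliptic_and_isGloballyMinimal₃ (check₃_of_checkW₃ h.1)).1
    haveI := (isElliptic_and_isGloballyMinimal₃ (check₃_of_checkW₃ h.1)).2
    ∀ (_hW16 : Wuthrich2014.charIdeal_dvd_padicLFunction) (_hS : Schneider1985_order_charGenerator_odd)
      (_h26 : AgasheRibetStein2006.cremona_abs_maninConstant_eq_one_of_level_le)
      {N : ℕ} [NeZero N] (D : ModularParametrizationData (R.e.baseChange ℚ) N)
      (_hopt : ∀ z ∈ D.L.lattice, ∃ w ∈ periodLattice D.f, z = D.c * w) (_hN : N ≤ 130000)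
      (_hLp : PowerSeries.coeff 2 (padicLFunction D.f (unitRoot (R.e.baseChange ℚ) 3 : ℚ_[3])) ≠ 0)
      (_hcoeff : (PowerSeries.coeff 2
        (padicLFunction D.f (unitRoot (R.e.baseChange ℚ) 3 : ℚ_[3]))).valuation = R.a)
      (Dh : PAdicHeightData (R.e.baseChange ℚ) 3) (_hDh : Dh.IsCanonical)
      (_hreg : (padicRegulator Dh).valuation = R.b),
      (R.e.baseChange ℚ).mordellWeilRank = 2 ∧
        Finite (AddCommGroup.primaryComponent (R.e.baseChange ℚ).sha 3) ∧ SchneiderConjecture Dh ∧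
        (padicValNat 3 (Nat.card (AddCommGroup.primaryComponent (R.e.baseChange ℚ).sha 3)) : ℤ) ≤
          R.k := by
  intro hW16 hS h26 N _ D hopt hN hLp hcoeff Dh hDh hreg
  haveI := (isElliptic_and_isGloballyMinimal₃ (check₃_of_checkW₃ h.1)).1
  haveI := (isElliptic_and_isGloballyMinimal₃ (check₃_of_checkW₃ h.1)).2
  exact w16₃ h.1 hW16 hS h26 D hopt hN h.2 hLp hcoeff Dh hDh hreg

end ShaRow

end Summit.BirchSwinnertonDyer.BirchSwinnertonDyer.Rank2Sha

end
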